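import Summits.BirchSwinnertonDyer.BirchSwinnertonDyer.Theorems.EisensteinPrimesTwoVariableInvariantsLift
import Mathlib.Algebra.Category.Grp.Injective
import Mathlib.GroupTheory.SpecificGroups.Cyclic
import HarnessLib

/-!
# The trivial-action lift: invariant classes of `H¹(S, M)` lift to `H¹(H, M)` when `H` acts trivially,
# `M` is divisible and `H/S` is topologically cyclic
# (helper file 18 for crux 2 `GoodLatticeBDPValue`, stmt-BirchSwinnertonDyer-19032, cell `bsd-eis` seat `bsd-eis-k5-c2`)

The `θ|_{G_K} = 𝟙` branch of the Galois control (MEMO-4 §3 R1; the «+1» of `CharMainConjOnTree`):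
there `A = (F/𝓞)(𝟙)` carries the TRIVIAL action, `A^S = A ≠ 0`, and the fixed-point-free lift of
`…TwoVariableInvariantsLift` does not apply. Its replacement, for normal subgroups `S ≤ H` of `Γ_K`,
a discrete `M` on which `H` acts trivially and which is DIVISIBLE, and `H/S`
topologically generated by one element `γ'` (every subgroup of `Γ_K` containing `S`, `γ'` and an open
neighbourhood of `1` in `H` contains `H` — e.g. `H = ker κ ⊇ S = pairKer κ κ'`, `κ'(γ') = 1`):

* `exists_resOfLe_eq_of_forall_conjH1_eq_of_trivial`: every `H`-invariant class of `H¹(S, M)` is a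
  restriction from `H¹(H, M)`. With trivial action a cocycle is a continuous homomorphism `c : S → M`
  and invariance says `c(h⁻¹sh) = c(s)`; the subgroup `H₁ = ker c · (N ∩ H)` (`N` open normal with
  `N ∩ S ⊆ ker c`) is open and normal in `H`, the image of `S` in `Q = H/H₁` is CENTRAL with cyclic
  quotient, so `Q` is abelian (`MonoidHom.isMulCommutative_of_isCyclic_of_ker_le_center`); `c`
  descends to the image of `S` and extends to `Q` by Baer's criterion for the divisible `M`
  (`Module.Baer.of_divisible`), and the composite `H → Q → M` is a continuous homomorphism
  restricting to `c`. This is the degree-one statement "`H¹(H, M) → H¹(S, M)^{H/S}` is onto" when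
  `H²(H/S, M) = 0` for `H/S ≅ ℤ_p` pro-cyclic and `M` divisible (`cd ℤ_p = 1`), proved by hand.

HONEST FRAMING: generic group cohomology; closes nothing by itself.
References: Neukirch–Schmidt–Wingberg (1.6.7), (1.6.13) (cd of `ℤ̂`/`ℤ_p`); Serre, *Galois Cohomology*
I §3.4; HOME/bsd-eis-ky-MEMO-1.md §3 R2 (i)–(ii).
-/

-- the summit namespace `Summit.BirchSwinnertonDyer.BirchSwinnertonDyer` repeats the problem name by design (D-0017)
set_option linter.dupNamespace false
set_option autoImplicit false

noncomputable section

open scoped Classical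

open Field Literature.NumberTheory.GaloisRepresentations Literature.NumberTheory.EllipticCurves

namespace Summit.BirchSwinnertonDyer.BirchSwinnertonDyer.Theorems.IwasawaTwoVariable

universe u

section Trivial

variable {K : Type u} [Field K] {S H : Subgroup (absoluteGaloisGroup K)} [S.Normal] [H.Normal]
  {M : Type u} [AddCommGroup M] [DistribMulAction (absoluteGaloisGroup K) M] [TopologicalSpace M]
  [DiscreteTopology M]

omit [S.Normal] [H.Normal] in
/-- With TRIVIAL `H`-action, a continuous cocycle on `S ≤ H` is additive. [folklore] -/
theorem cocycle_mul_of_trivial (hSH : S ≤ H)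
    (htriv : ∀ h ∈ H, ∀ m : M, h • m = m) (c : contOneCocycles (discreteTopRep S M)) (s t : S) :
    c.1 (s * t) = c.1 s + c.1 t := by
  have h := c.2 s t
  change c.1 (s * t) = c.1 s + (s : absoluteGaloisGroup K) • c.1 t at h
  rwa [htriv _ (hSH s.2)] at h

omit [S.Normal] [H.Normal] in
/-- With trivial action, `c(s⁻¹) = −c(s)`. [folklore] -/
theorem cocycle_inv_of_trivial (hSH : S ≤ H)
    (htriv : ∀ h ∈ H, ∀ m : M, h • m = m) (c : contOneCocycles (discreteTopRep S M)) (s : S) :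
    c.1 s⁻¹ = -c.1 s := by
  have h := cocycle_mul_of_trivial hSH htriv c s⁻¹ s
  rw [inv_mul_cancel, contOneCocycles.apply_one] at h
  exact eq_neg_of_add_eq_zero_left h.symm

omit [H.Normal] in
/-- With trivial action, an `H`-invariant class is `H`-invariant VALUEWISE: `c(h⁻¹ s h) = c(s)`
(coboundaries vanish). [folklore] -/
theorem apply_conj_eq_of_trivial (hSH : S ≤ H)
    (htriv : ∀ h ∈ H, ∀ m : M, h • m = m) (c : contOneCocycles (discreteTopRep S M))
    (hx : ∀ g ∈ H, conjH1 S M g (oneCocycleClass (discreteTopRep S M) c) =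
      oneCocycleClass (discreteTopRep S M) c)
    {h : absoluteGaloisGroup K} (hh : h ∈ H) (s : S) :
    c.1 (subgroupConj S h s) = c.1 s := by
  obtain ⟨v, hv⟩ := exists_conj_sub_eq_of_conjH1_eq h c (hx h hh)
  have := hv s
  rwa [htriv _ hh, htriv _ (hSH s.2), sub_self, sub_eq_zero] at this

/-- **The trivial-action lift.** `S ≤ H` normal subgroups of `Γ_K`; `M` discrete, DIVISIBLE,
with TRIVIAL `H`-action; `γ' ∈ H` such that every subgroup of `Γ_K` containing `S`, `γ'` and a
neighbourhood `N ∩ H` of `1` in `H` (`N` open normal in `Γ_K`) contains `H` ("`H/S` is topologically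
generated by `γ'`"). Then every `H`-invariant class of `H¹(S, M)` is the restriction of a class of
`H¹(H, M)`. [cite: NeukirchSchmidtWingberg2008, (1.6.7)] -/
theorem exists_resOfLe_eq_of_forall_conjH1_eq_of_trivial (hSH : S ≤ H)
    (hdiv : DivisibleBy M ℤ) (htriv : ∀ h ∈ H, ∀ m : M, h • m = m)
    {γ' : absoluteGaloisGroup K} (hγ' : γ' ∈ H)
    (hgen : ∀ P : Subgroup (absoluteGaloisGroup K),
      (∃ N : OpenNormalSubgroup (absoluteGaloisGroup K),
        (N : Subgroup (absoluteGaloisGroup K)) ⊓ H ≤ P) → S ≤ P → γ' ∈ P → H ≤ P)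
    (x : subgroupH1 S M) (hx : ∀ g ∈ H, conjH1 S M g x = x) :
    ∃ y : subgroupH1 H M, resOfLe M hSH y = x := by
  haveI : CompactSpace (absoluteGaloisGroup K) := absoluteGaloisGroup_compactSpace K
  haveI : DivisibleBy M ℤ := hdiv
  obtain ⟨c, rfl⟩ := oneCocycleClass_surjective _ x
  have hadd := cocycle_mul_of_trivial hSH htriv c
  have hneg := cocycle_inv_of_trivial hSH htriv c
  have hone : c.1 1 = 0 := contOneCocycles.apply_one c
  have hfix : ∀ {h : absoluteGaloisGroup K}, h ∈ H → ∀ s : S, c.1 (subgroupConj S h s) = c.1 s :=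
    fun hh s ↦ apply_conj_eq_of_trivial hSH htriv c hx hh s
  -- conjugates written as elements of `S`
  have hconjS : ∀ (g : absoluteGaloisGroup K) (s : S), g * s * g⁻¹ ∈ S := fun g s ↦
    Subgroup.Normal.conj_mem inferInstance _ s.2 g
  have hfix' : ∀ {g : absoluteGaloisGroup K}, g ∈ H → ∀ s : S,
      c.1 ⟨g * s * g⁻¹, hconjS g s⟩ = c.1 s := by
    intro g hg s
    have h := hfix (H.inv_mem hg) s
    have e : subgroupConj S g⁻¹ s = ⟨g * s * g⁻¹, hconjS g s⟩ := Subtype.ext (by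
      simp only [subgroupConj_apply_coe, inv_inv])
    rwa [e] at h
  -- an open normal `N` with `N ∩ S ⊆ ker c`
  have hz : IsOpen {s : S | c.1 s = 0} := (isOpen_discrete ({0} : Set M)).preimage c.1.continuous
  obtain ⟨V, hV, hVeq⟩ := isOpen_induced_iff.mp hz
  have h1V : (1 : absoluteGaloisGroup K) ∈ V := by
    have : (1 : S) ∈ Subtype.val ⁻¹' V := by rw [hVeq]; exact hone
    exact this
  obtain ⟨N, hN⟩ := ProfiniteGrp.exist_openNormalSubgroup_sub_open_nhds_of_one hV h1V
  have hNc : ∀ (n : absoluteGaloisGroup K) (hn : n ∈ S), n ∈ N → c.1 ⟨n, hn⟩ = 0 := by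
    intro n hn hnN
    have : (⟨n, hn⟩ : S) ∈ Subtype.val ⁻¹' V := hN hnN
    rw [hVeq] at this
    exact this
  -- the open normal subgroup `H₁ = ker c · (N ∩ H)` of `H`
  let H₁ : Subgroup H :=
    { carrier := {h | ∃ (s : S) (n : absoluteGaloisGroup K), n ∈ N ∧ n ∈ H ∧ c.1 s = 0 ∧
        (h : absoluteGaloisGroup K) = s * n}
      mul_mem' := by
        rintro a b ⟨s, n, hnN, hnH, hs, ha⟩ ⟨s', n', hn'N, hn'H, hs', hb⟩
        refine ⟨s * ⟨n * s' * n⁻¹, hconjS n s'⟩, n * n', N.toSubgroup.mul_mem hnN hn'N,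
          H.mul_mem hnH hn'H, ?_, ?_⟩
        · rw [hadd, hs, hfix' hnH, hs', add_zero]
        · rw [Subgroup.coe_mul, ha, hb, Subgroup.coe_mul]
          simp only [mul_assoc, inv_mul_cancel_left]
      one_mem' := ⟨1, 1, N.toSubgroup.one_mem, H.one_mem, hone, by simp⟩
      inv_mem' := by
        rintro a ⟨s, n, hnN, hnH, hs, ha⟩
        refine ⟨⟨n⁻¹ * s⁻¹ * n⁻¹⁻¹, hconjS n⁻¹ s⁻¹⟩, n⁻¹, N.toSubgroup.inv_mem hnN, H.inv_mem hnH,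
          ?_, ?_⟩
        · rw [hfix' (H.inv_mem hnH), hneg, hs, neg_zero]
        · change ((a : absoluteGaloisGroup K))⁻¹ =
            (n⁻¹ * ((s : absoluteGaloisGroup K))⁻¹ * n⁻¹⁻¹) * n⁻¹
          rw [ha]
          simp only [mul_inv_rev, inv_inv, mul_assoc, mul_inv_cancel, mul_one] }
  have hH₁_normal : H₁.Normal := ⟨by
    rintro a ⟨s, n, hnN, hnH, hs, ha⟩ g
    refine ⟨⟨(g : absoluteGaloisGroup K) * s * (g : absoluteGaloisGroup K)⁻¹, hconjS g s⟩,
      (g : absoluteGaloisGroup K) * n * (g : absoluteGaloisGroup K)⁻¹,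
      Subgroup.Normal.conj_mem inferInstance _ hnN _,
      Subgroup.Normal.conj_mem inferInstance _ hnH _, ?_, ?_⟩
    · rw [hfix' g.2, hs]
    · change (g : absoluteGaloisGroup K) * a * ((g : absoluteGaloisGroup K))⁻¹ = _
      rw [ha]
      simp only [mul_assoc, inv_mul_cancel_left]⟩
  haveI := hH₁_normal
  have hmemH₁_N : ∀ (n : H), (n : absoluteGaloisGroup K) ∈ N → n ∈ H₁ := fun n hn ↦
    ⟨1, n, hn, n.2, hone, by simp⟩
  -- the quotient `Q = H/H₁`, the map `S → Q`, and its fibres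
  let Q := H ⧸ H₁
  let mk : H →* Q := QuotientGroup.mk' H₁
  have hmk1 : ∀ n : H, (n : absoluteGaloisGroup K) ∈ N → mk n = 1 := fun n hn ↦
    (QuotientGroup.eq_one_iff n).2 (hmemH₁_N n hn)
  let fS : S →* Q := mk.comp (Subgroup.inclusion hSH)
  have hfS : ∀ s : S, fS s = mk ⟨s, hSH s.2⟩ := fun _ ↦ rfl
  have hwd : ∀ s s' : S, fS s = fS s' → c.1 s = c.1 s' := by
    intro s s' h
    rw [hfS, hfS, QuotientGroup.mk'_apply, QuotientGroup.mk'_apply, QuotientGroup.eq] at h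
    obtain ⟨s₀, n, hnN, -, hs₀, hsn⟩ := h
    have hnS : n ∈ S := by
      have e : n = (s₀ : absoluteGaloisGroup K)⁻¹ * ((s : absoluteGaloisGroup K)⁻¹ * s') := by
        rw [← show ((⟨s, hSH s.2⟩⁻¹ * ⟨s', hSH s'.2⟩ : H) : absoluteGaloisGroup K) =
          (s : absoluteGaloisGroup K)⁻¹ * s' from rfl, hsn, inv_mul_cancel_left]
      rw [e]
      exact S.mul_mem (S.inv_mem s₀.2) (S.mul_mem (S.inv_mem s.2) s'.2)
    have hcn : c.1 ⟨n, hnS⟩ = 0 := hNc n hnS hnN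
    have e2 : s⁻¹ * s' = s₀ * ⟨n, hnS⟩ := Subtype.ext (by
      change (s : absoluteGaloisGroup K)⁻¹ * s' = s₀ * n
      exact hsn)
    have := congrArg c.1 e2
    rw [hadd, hadd, hneg, hs₀, hcn, add_zero, neg_add_eq_zero] at this
    exact this
  -- the image of `S` is central in `Q`
  have hcentral : ∀ (h : H) (s : S), mk h * fS s = fS s * mk h := by
    intro h s
    rw [hfS, ← map_mul, ← map_mul, QuotientGroup.mk'_apply, QuotientGroup.mk'_apply,
      QuotientGroup.eq]
    refine ⟨⟨(s : absoluteGaloisGroup K)⁻¹ * ((h : absoluteGaloisGroup K)⁻¹ * s * h),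
      S.mul_mem (S.inv_mem s.2) (conj_mem_of_normal S h s)⟩, 1, N.toSubgroup.one_mem, H.one_mem,
      ?_, ?_⟩
    · have e : (⟨(s : absoluteGaloisGroup K)⁻¹ * ((h : absoluteGaloisGroup K)⁻¹ * s * h), _⟩ : S) =
          s⁻¹ * subgroupConj S h s := Subtype.ext rfl
      rw [e, hadd, hneg, hfix h.2, neg_add_cancel]
    · simp only [Subgroup.coe_mul, Subgroup.coe_inv, mul_inv_rev, mul_one, mul_assoc]
  -- `Q` is abelian: central image of `S`, cyclic quotient generated by `γ'`
  let H₂ : Subgroup H :=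
    { carrier := {h | ∃ (s : S) (n : absoluteGaloisGroup K), n ∈ N ∧ n ∈ H ∧
        (h : absoluteGaloisGroup K) = s * n}
      mul_mem' := by
        rintro a b ⟨s, n, hnN, hnH, ha⟩ ⟨s', n', hn'N, hn'H, hb⟩
        refine ⟨s * ⟨n * s' * n⁻¹, hconjS n s'⟩, n * n', N.toSubgroup.mul_mem hnN hn'N,
          H.mul_mem hnH hn'H, ?_⟩
        rw [Subgroup.coe_mul, ha, hb, Subgroup.coe_mul]
        simp only [mul_assoc, inv_mul_cancel_left]
      one_mem' := ⟨1, 1, N.toSubgroup.one_mem, H.one_mem, by simp⟩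
      inv_mem' := by
        rintro a ⟨s, n, hnN, hnH, ha⟩
        refine ⟨⟨n⁻¹ * s⁻¹ * n⁻¹⁻¹, hconjS n⁻¹ s⁻¹⟩, n⁻¹, N.toSubgroup.inv_mem hnN, H.inv_mem hnH, ?_⟩
        change ((a : absoluteGaloisGroup K))⁻¹ =
          (n⁻¹ * ((s : absoluteGaloisGroup K))⁻¹ * n⁻¹⁻¹) * n⁻¹
        rw [ha]
        simp only [mul_inv_rev, inv_inv, mul_assoc, mul_inv_cancel, mul_one] }
  have hH₂_normal : H₂.Normal := ⟨by
    rintro a ⟨s, n, hnN, hnH, ha⟩ g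
    refine ⟨⟨(g : absoluteGaloisGroup K) * s * (g : absoluteGaloisGroup K)⁻¹, hconjS g s⟩,
      (g : absoluteGaloisGroup K) * n * (g : absoluteGaloisGroup K)⁻¹,
      Subgroup.Normal.conj_mem inferInstance _ hnN _,
      Subgroup.Normal.conj_mem inferInstance _ hnH _, ?_⟩
    change (g : absoluteGaloisGroup K) * a * ((g : absoluteGaloisGroup K))⁻¹ = _
    rw [ha]
    simp only [mul_assoc, inv_mul_cancel_left]⟩
  haveI := hH₂_normal
  have h12 : H₁ ≤ H₂ := by
    rintro a ⟨s, n, hnN, hnH, -, ha⟩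
    exact ⟨s, n, hnN, hnH, ha⟩
  let f : Q →* H ⧸ H₂ := QuotientGroup.map H₁ H₂ (MonoidHom.id H) h12
  haveI : IsCyclic (H ⧸ H₂) := by
    rw [isCyclic_iff_exists_zpowers_eq_top]
    refine ⟨QuotientGroup.mk' H₂ ⟨γ', hγ'⟩, eq_top_iff.2 ?_⟩
    rintro q -
    obtain ⟨h, rfl⟩ := QuotientGroup.mk'_surjective H₂ q
    -- `hgen` applied to the preimage of the cyclic subgroup
    let P : Subgroup (absoluteGaloisGroup K) :=
      ((Subgroup.zpowers (QuotientGroup.mk' H₂ ⟨γ', hγ'⟩)).comap (QuotientGroup.mk' H₂)).map H.subtype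
    have hPmem : ∀ (g : absoluteGaloisGroup K) (hg : g ∈ H),
        QuotientGroup.mk' H₂ ⟨g, hg⟩ ∈ Subgroup.zpowers (QuotientGroup.mk' H₂ ⟨γ', hγ'⟩) → g ∈ P :=
      fun g hg hm ↦ ⟨⟨g, hg⟩, hm, rfl⟩
    have hone₂ : ∀ (g : absoluteGaloisGroup K) (hg : g ∈ H), (⟨g, hg⟩ : H) ∈ H₂ →
        QuotientGroup.mk' H₂ ⟨g, hg⟩ ∈ Subgroup.zpowers (QuotientGroup.mk' H₂ ⟨γ', hγ'⟩) := by
      intro g hg hmem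
      rw [QuotientGroup.mk'_apply H₂ ⟨g, hg⟩, (QuotientGroup.eq_one_iff _).2 hmem]
      exact Subgroup.one_mem _
    have hHP : H ≤ P := by
      refine hgen P ⟨N, ?_⟩ ?_ ?_
      · rintro g ⟨hgN, hgH⟩
        exact hPmem g hgH (hone₂ g hgH ⟨1, g, hgN, hgH, by simp⟩)
      · intro g hg
        exact hPmem g (hSH hg) (hone₂ g (hSH hg) ⟨⟨g, hg⟩, 1, N.toSubgroup.one_mem, H.one_mem, by simp⟩)
      · exact hPmem γ' hγ' (Subgroup.mem_zpowers _)
    obtain ⟨h', hh', hh'eq⟩ := hHP h.2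
    have : h' = h := Subtype.ext hh'eq
    rw [← this]
    exact hh'
  have hker : f.ker ≤ Subgroup.center Q := by
    intro q hq
    obtain ⟨h, rfl⟩ := QuotientGroup.mk'_surjective H₁ q
    rw [MonoidHom.mem_ker] at hq
    have hq' : QuotientGroup.mk' H₂ h = 1 := by
      rw [← hq]
      rfl
    rw [QuotientGroup.mk'_apply, QuotientGroup.eq_one_iff] at hq'
    obtain ⟨s, n, hnN, hnH, hsn⟩ := hq'
    have e : mk h = fS s := by
      have : h = ⟨s, hSH s.2⟩ * ⟨n, hnH⟩ := Subtype.ext (by rw [hsn]; rfl)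
      rw [this, map_mul, hmk1 ⟨n, hnH⟩ hnN, mul_one]
      rfl
    rw [Subgroup.mem_center_iff]
    intro q'
    obtain ⟨h', rfl⟩ := QuotientGroup.mk'_surjective H₁ q'
    change mk h' * mk h = mk h * mk h'
    rw [e, hcentral]
  have hcomm : ∀ a b : Q, a * b = b * a :=
    (f.isMulCommutative_of_isCyclic_of_ker_le_center hker).is_comm.comm
  letI : CommGroup Q := { (inferInstance : Group Q) with mul_comm := hcomm }
  -- `c` descends to the image `C` of `S` in `Q` …
  let C : Subgroup Q := fS.range
  have hchoose : ∀ y : C, ∃ s : S, fS s = y := fun y ↦ MonoidHom.mem_range.1 y.2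
  let χ : Additive C →+ M :=
    { toFun := fun y ↦ c.1 (Classical.choose (hchoose (Additive.toMul y)))
      map_zero' := by
        have h := Classical.choose_spec (hchoose (Additive.toMul (0 : Additive C)))
        change c.1 (Classical.choose (hchoose (Additive.toMul (0 : Additive C)))) = 0
        rw [← hone]
        exact hwd _ _ (by rw [h, map_one]; rfl)
      map_add' := fun y y' ↦ by
        have h := Classical.choose_spec (hchoose (Additive.toMul (y + y')))
        have hy := Classical.choose_spec (hchoose (Additive.toMul y))
        have hy' := Classical.choose_spec (hchoose (Additive.toMul y'))
        change c.1 (Classical.choose (hchoose (Additive.toMul (y + y')))) =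
          c.1 (Classical.choose (hchoose (Additive.toMul y))) +
            c.1 (Classical.choose (hchoose (Additive.toMul y')))
        rw [← hadd]
        apply hwd
        rw [map_mul, h, hy, hy']
        rfl }
  have hχ : ∀ s : S, χ (Additive.ofMul ⟨fS s, MonoidHom.mem_range.2 ⟨s, rfl⟩⟩) = c.1 s := by
    intro s
    have h := Classical.choose_spec (hchoose ⟨fS s, MonoidHom.mem_range.2 ⟨s, rfl⟩⟩)
    exact hwd _ _ h
  -- … and extends to `Q` by Baer's criterion for the divisible `M`
  obtain ⟨ψ, hψ⟩ := Module.Baer.extension_property_addMonoidHom (Module.Baer.of_divisible M)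
    (MonoidHom.toAdditive C.subtype) (fun a b h ↦ Subtype.ext h) χ
  -- the lift `H → M`
  let m : H → M := fun h ↦ ψ (Additive.ofMul (mk h))
  have hm_mul : ∀ a b : H, m (a * b) = m a + m b := fun a b ↦ by
    change ψ (Additive.ofMul (mk (a * b))) = ψ (Additive.ofMul (mk a)) + ψ (Additive.ofMul (mk b))
    rw [map_mul, ofMul_mul, map_add]
  have hm_S : ∀ s : S, m ⟨s, hSH s.2⟩ = c.1 s := by
    intro s
    have h := DFunLike.congr_fun hψ (Additive.ofMul ⟨fS s, MonoidHom.mem_range.2 ⟨s, rfl⟩⟩)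
    rw [AddMonoidHom.comp_apply] at h
    rw [← hχ s, ← h]
    rfl
  have hm_N : ∀ n : H, (n : absoluteGaloisGroup K) ∈ N → m n = 0 := fun n hn ↦ by
    change ψ (Additive.ofMul (mk n)) = 0
    rw [hmk1 n hn, ofMul_one, map_zero]
  -- continuity: `m` is constant on the cosets of the open `N ∩ H`
  have hcont : Continuous m := by
    refine continuous_def.2 fun U _ ↦ ?_
    rw [isOpen_iff_forall_mem_open]
    intro g₀ hg₀
    refine ⟨(fun g : H ↦ ((g₀⁻¹ * g : H) : absoluteGaloisGroup K)) ⁻¹'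
        ((N : Subgroup (absoluteGaloisGroup K)) : Set (absoluteGaloisGroup K)), ?_, ?_, ?_⟩
    · intro g hg
      have hg' : ((g₀⁻¹ * g : H) : absoluteGaloisGroup K) ∈ N := hg
      have e : m g = m g₀ := by
        rw [← mul_inv_cancel_left g₀ g, hm_mul, hm_N _ hg', add_zero]
      show m g ∈ U
      rw [e]
      exact hg₀
    · exact N.isOpen.preimage (continuous_subtype_val.comp (continuous_const.mul continuous_id))
    · show ((g₀⁻¹ * g₀ : H) : absoluteGaloisGroup K) ∈ N
      rw [inv_mul_cancel]
      exact one_mem _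
  -- the lifted cocycle and its restriction
  let cH : contOneCocycles (discreteTopRep H M) :=
    ⟨⟨m, hcont⟩, fun a b ↦ by
      change m (a * b) = m a + (a : absoluteGaloisGroup K) • m b
      rw [htriv _ a.2, hm_mul]⟩
  refine ⟨oneCocycleClass (discreteTopRep H M) cH, ?_⟩
  rw [resOfLe_oneCocycleClass]
  congr 1
  apply Subtype.ext
  ext s
  exact hm_S s

end Trivial

end Summit.BirchSwinnertonDyer.BirchSwinnertonDyer.Theorems.IwasawaTwoVariable

end
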